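import Summits.AtomisticToContinuum.BoseEinsteinCondensation.Theorems.BECCutLineWeakDisorderTracerDefs
import Summits.AtomisticToContinuum.BoseEinsteinCondensation.Theorems.BECCutLineWeakDisorderTwoReplicaTransienceBoundFactorisation
import Summits.AtomisticToContinuum.BoseEinsteinCondensation.Theorems.BECCutLineWeakDisorderTwoReplicaTransienceBoundTracerMeasurable
import Summits.AtomisticToContinuum.BoseEinsteinCondensation.Theorems.BECCutLineWeakDisorderTwoReplicaTransienceBoundTiltedDecoupling
import HarnessLib

/-!
# Route `BECCutLineWeakDisorder`, crux `TwoReplicaTransienceBound` (stmt-AtomisticToContinuum-9687):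
# the crux from the engine, in one theorem (line `SketchIdeator1`, tracer decoupling, v4)

Helper file of the line (continuation lead, 2026-08-16). The four bookkeeping stubs of the checked
skeleton `Cruxes/TwoReplicaTransienceBound/Lines/SketchIdeator1.lean` are theorems of the tree
(`stub_factorisation` p97386, `stub_tracerMeasurable` p98734, `stub_decoupling` p100473,
`stub_tiltedDecoupling` p105635) and the composition `stub_tiltedCompose` (p102359) is sorry-free, so the
reduction of the crux to the ONE open engine statement `TracerProfileBound`
(`Theorems/BECCutLineWeakDisorderDefs.lean`) can now be stated without hypotheses other than the engine:

* `sliceMoment_le_tilted` — the unconditional slice inequality behind the line: for measurable `v`,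
  `T ≥ 0` and every bath slice `Y`,
  `m(Y) = ∫ₓ Z_T(x::Y)² ≤ s(Y) · ∫ fkWeight(Y,ωb) · (∫ₓ g² / ∫ₓ g) dW_n(ωb)`, `s(Y) = ∫ₓ Z_T(x::Y)`,
  `g = tracer v L T · Y ωb` (factorisation of `Z_T(x::Y)` through the passive tracer, joint measurability,
  Cauchy–Schwarz with the weights `fkWeight·∫ₓg`);
* `cutRatio_le_tilted` — hence the crux's slice integrand obeys
  `L³ m(Y)²/s(Y)² ≤ L³ m(Y)·[∫ fkWeight (∫ₓg²/∫ₓg) dW_n]/s(Y)` (`[0,∞]` arithmetic `sq_div_sq_le_mul_div`);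
* `stub_engineCompose` (registered bookkeeping stub) / `twoReplicaTransienceBound_of_tracerProfileBound` —
  **`TracerProfileBound → TwoReplicaTransienceBound`**, the whole line in one implication (same `ρ₀`, same `C`).

Nothing here is conditional on an unproved fact except through the explicit hypothesis of the last theorem;
the engine itself (bounded mean quenched participation ratio of the tracer's survival profile, eventually in
`n`, uniformly in `T ≥ 1`) is the open content of the crux (cards `tracer-decoupling`, `static-response-recoil`).
-/

noncomputable section

namespace Summit.AtomisticToContinuum.BoseEinsteinCondensation.Cruxes.TwoReplicaTransienceBound.TracerDecoupling

open MeasureTheory Filter Set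
open scoped ENNReal NNReal Topology BigOperators
open Literature.MathematicalPhysics.QuantumManyBody.BoseGas

variable {n : ℕ}

/-- **Tilted slice decoupling, unconditionally**: for measurable `v`, `0 ≤ T`, and every bath slice `Y`,
`∫ₓ Z_T(x::Y)² ≤ (∫ₓ Z_T(x::Y)) · ∫ fkWeight v L T Y ωb · (∫ₓ tracer² / ∫ₓ tracer) dW_n(ωb)`
(the landed stubs `stub_factorisation`, `stub_tracerMeasurable`, `stub_tiltedDecoupling` combined). -/
theorem sliceMoment_le_tilted {v : ℝ → ℝ≥0∞} (hv : Measurable v) (L : ℝ) {T : ℝ} (hT : 0 ≤ T)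
    (Y : Config n) :
    ∫⁻ x, fkPartition v L T (Matrix.vecCons x Y) ^ 2 ≤
      (∫⁻ x, fkPartition v L T (Matrix.vecCons x Y)) *
        ∫⁻ ωb, fkWeight v L T Y ωb *
          ((∫⁻ x, tracer v L T x Y ωb ^ 2) / ∫⁻ x, tracer v L T x Y ωb) ∂wienerPaths n :=
  stub_tiltedDecoupling n v hv L T Y hT (fun x => stub_factorisation n v hv L T x Y)
    (stub_tracerMeasurable n v hv L T Y)

/-- **The crux's slice integrand is dominated by the engine's**: for measurable `v`, `0 ≤ T`, every `Y`,
`L³ m(Y)²/s(Y)² ≤ L³ m(Y) · [∫ fkWeight (∫ₓ tracer²/∫ₓ tracer) dW_n] / s(Y)` in `[0, ∞]`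
(`m ≤ s·P ⟹ m²/s² ≤ m·P/s`). -/
theorem cutRatio_le_tilted {v : ℝ → ℝ≥0∞} (hv : Measurable v) (L : ℝ) {T : ℝ} (hT : 0 ≤ T)
    (Y : Config n) :
    ENNReal.ofReal (L ^ 3) * (∫⁻ x, fkPartition v L T (Matrix.vecCons x Y) ^ 2) ^ 2 /
        (∫⁻ x, fkPartition v L T (Matrix.vecCons x Y)) ^ 2 ≤
      ENNReal.ofReal (L ^ 3) *
        ((∫⁻ x, fkPartition v L T (Matrix.vecCons x Y) ^ 2) *
          ∫⁻ ωb, fkWeight v L T Y ωb *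
            ((∫⁻ x, tracer v L T x Y ωb ^ 2) / ∫⁻ x, tracer v L T x Y ωb) ∂wienerPaths n) /
        (∫⁻ x, fkPartition v L T (Matrix.vecCons x Y)) := by
  rw [mul_div_assoc, mul_div_assoc]
  exact mul_le_mul' le_rfl (sq_div_sq_le_mul_div (sliceMoment_le_tilted hv L hT Y))

/-- **Registered bookkeeping stub `stub_engineCompose` (v4): the engine alone gives the crux.**
`Goal.stub_tracerProfileBound` (bounded mean of the quenched participation ratio of the passive tracer's
survival profile, eventually in `n`, uniformly in `T ≥ 1`) implies `TwoReplicaTransienceBound` with the same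
`ρ₀` and `C` (composition `stub_tiltedCompose` fed with the landed stubs `stub_factorisation`,
`stub_tracerMeasurable`, `stub_tiltedDecoupling`). -/
theorem stub_engineCompose :
    Goal.stub_tracerProfileBound →
      Summit.AtomisticToContinuum.BoseEinsteinCondensation.Theses.BECCutLineWeakDisorder.TwoReplicaTransienceBound :=
  stub_tiltedCompose stub_factorisation stub_tracerMeasurable stub_tiltedDecoupling

/-- **The line in one implication** (readable alias of `stub_engineCompose`): `TracerProfileBound`, the
engine, implies the crux `TwoReplicaTransienceBound`. -/
theorem twoReplicaTransienceBound_of_tracerProfileBound (hE : TracerProfileBound) :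
    Summit.AtomisticToContinuum.BoseEinsteinCondensation.Theses.BECCutLineWeakDisorder.TwoReplicaTransienceBound :=
  stub_engineCompose hE

end Summit.AtomisticToContinuum.BoseEinsteinCondensation.Cruxes.TwoReplicaTransienceBound.TracerDecoupling

end
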